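import Literature.MathematicalPhysics.QuantumFieldTheory.Balaban1983to89.T4RemnantBooking
import Literature.MathematicalPhysics.QuantumFieldTheory.Balaban1983to89.T4Crossover

/-!
# `Balaban1983to89.T4BookingNecessity` — NECESSITY and EXACT THRESHOLDS for the recent-window bookings of the
two-run matching (cell `pub-balaban`, T4-DAG v7 §5 rows T4-U5.R / T4-U5.E-b / T4-U5.E-CLOSE / T4-U4′; referee report
`t4/T4-REF-U5.md` v1.1 §2 F2 / F3 and [v1.1 P3]; records `t4/T4-EST-U5E-b-R1.md`, `t4/T4-EST-U5E-rem.md`; kernel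
siblings `T4RemnantBooking` (sufficiency of the remnant booking), `T4GoodClassBudget` §3b (the log window),
`T4Crossover` (crossover lemma (ii)))

HONEST FRAMING (cell `pub-balaban`, T4-DAG PAGE 1).  The cell's T4 target is the existence AND uniqueness of the
continuum limit of Bałaban's unit-scale averaged loop expectations on a finite torus — strictly beyond ultraviolet
stability ([Balaban1989LargeFieldII] Thm 1 p. 355); it is NOT the Yang–Mills mass gap and NOT the Clay problem.  This
module is the REFEREE'S side of the booking arithmetic: where the sibling modules prove that certain per-`K` budgets ARE
summable under stated conditions, this module proves (a) that the conditions cannot be dropped — the corresponding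
NON-summabilities — and (b) the EXACT thresholds.  NOTHING of Bałaban's estimates is proved or assumed here; every
statement is real-number arithmetic about the cell's bookkeeping shapes. [folklore arithmetic]

WHAT IS KERNEL-CHECKED.
* §1 tools: eventual comparison from below (`not_summable_of_eventually_le`), the shifted p-series
  (`summable_succ_rpow_iff`), `A₀·(log(Mx))^{p₀} ≤ c·x` eventually (`eventually_mul_log_pow_le`), and
  `ageCut C K ≤ K` eventually (so the log window has its full length `ageCut C K = ⌈C·log(K+1)⌉`).
* §2 WINDOW-LENGTH FACTORS do not move a strict polynomial threshold but a linear length does: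
  `Σ_K (C·log(K+1)+1)·(K+1)^{−q} < ∞ ↔ 1 < q` (`summable_logLength_mul_rpow_iff`) and the exact converse of
  `T4Crossover.summable_succ_mul_inv_rpow`: `Σ_K (K+1)·(c(K+1))^{−p} < ∞ ↔ 2 < p` (`summable_succ_mul_inv_rpow_iff`).
* §3 THE EXACT OLD-REMNANT THRESHOLD: for `0 < ρ < 1 ≤ Λ`, `C, C′ ≥ 0`,
  `Σ_K Λ^{ageCut C K}·ρ^{ageCut C′ K} < ∞ ↔ 1 < C′(−log ρ) − C·log Λ` (`summable_pow_ageCut_mul_iff`; `Λ := 1`: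
  `summable_pow_ageCut_iff`), hence, in the exact shape of `T4RemnantBooking.summable_remnantOld_logWindow`:
  SUFFICIENCY already under `1 < C′(−log ρ) − C·log Λ` (`summable_remnantOld_logWindow_sharp`, improving that lemma's
  `⌈C·log Λ⌉ + 3 ≤ C′(−log ρ)`), and NECESSITY of the same inequality when the hypothesis shape `RemnantAgeBound` is
  SATURATED, `remOld j A = E₀ρ^A` with `E₀ > 0` (`one_lt_of_summable_remnantOld_saturated`,
  `summable_remnantOld_logWindow_iff_of_saturated`); bank form `ρ = e^{−c}`: `1 < C′·c − C·log Λ` suffices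
  (`summable_remnantOld_logWindow_bank_sharp`, cf. `T4RemnantBooking.summable_remnantOld_logWindow_bank`).  So the
  referee's arithmetic `t4/T4-REF-U5.md` F2 [v1.1 P3] is now kernel-checked in both directions.
* §4 NO SIZE-ONLY BOOKING INSIDE THE LOG WINDOW ALONG ASYMPTOTIC FREEDOM (`t4/T4-REF-U5.md` F2 (a)/F3): under the
  two-sided endpoint running `Step.Discrete031 b β′ K g (gs K)` (`b, β′ ≥ 0`, `0 < g ≤ 1`) the couplings on the log
  window `jlogOf C K ≤ j ≤ K` obey `1 ≤ g_j^{−2} ≤ (g^{−2} + β′(C+1))·log(K+1)` eventually in `K`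
  (`eventually_inv_sq_le_mul_log`), whence for EVERY `q > 0`, eventually in `K` and uniformly on the window,
  `(K+1)^{−q} ≤ exp(−p₀(g_j))` with `p₀(g) = A₀(log g^{−2})^{p₀}` the tree's `p0Profile` (`A₀ ≥ 0`;
  `eventually_rpow_neg_le_exp_neg_p0Profile`) and `(K+1)^{−q} ≤ g_j^{κ₀}` (`eventually_rpow_neg_le_pow`): the
  one-run smallness factors `e^{−p₀(g_j)}` ((1.100) p. 390) and `g_j^{κ₀}` decay SLOWER THAN ANY POWER of `K` on the
  window, so no per-`K` selection of such terms with multiplicities `≥ 1` is summable in `K`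
  (`not_summable_exp_neg_p0Profile_select`, `not_summable_pow_select`) — a rate (`θ^j`) or an age-resolved gain
  (`ρ^{A(K)}`, §3) is indispensable there.  (The complementary sufficiency statements are `T4Crossover` §3 for
  `g_j^{κ₀}` on the OLD scales and `T4RemnantBooking` §2–§3.)
* §5 THE RECENT-RATE COEFFICIENT of `T4Crossover.min_le_of_remaining_le`: `Σ_K (θ(Λ/θ)^σ)^K < ∞ ↔
  σ·log(Λ/θ) < log θ⁻¹` (`summable_recentRate_pow_iff`; for `θ < Λ`: `↔ σ < log θ⁻¹/log(Λ/θ)`,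
  `summable_recentRate_pow_iff_lt_div`; `T4Crossover.exists_recentRate_lt_one` exhibits `σ` at half that value).

CITATION HEADER (LOCATORS ONLY — formulas below are transliterations for orientation, read by this seat on the rendered
pages of the cell's page store `b2b-balaban-ref1/pages/1989-cmp122-large-field-II/…` AS IMAGES, 2026-08-19; nothing
below is used as a hypothesis and nothing is quoted as authority).
* [Balaban1989LargeFieldII] T. Bałaban, *Large field renormalization. II. Localization, exponentiation, and bounds for
  the R operation*, Commun. Math. Phys. 122 (1989) 355–392: (1.89) p. 387 (`𝐓′_k(X)1 ≤ exp(−2(1+β₀)^{−1}p₀(g_k))`);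
  (1.92) p. 388 (one such factor per hosted component); (1.99)/(1.100) p. 390 (`|𝐑′^{(k)}(X,(𝐔,𝐉))| ≤
  exp(−p₀(g_k)) exp(−κd_k(X))` for the second group of terms; the first group `𝐁′^{(k)}` carries `c₁ = α^{1/3}` in
  (1.99), cf. the `T4RemnantBooking` header) — the ONE-RUN sizes of the step-`k` remnants whose `K`-bookkeeping §4
  addresses.
* [Balaban1988Convergent] T. Bałaban, *Convergent renormalization expansions …*, Commun. Math. Phys. 119 (1988)
  243–285: the profile `p₀(g) = A₀(log g⁻²)^{p₀}` (1.1) p. 246 is the tree's `p0Profile` (`Setup`, whose docstring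
  carries the locator); the flow inequalities (2.6)–(2.9) p. 255–256 are the tree's `B14.FlowIneq26`–`FlowIneq29`
  (not used here).
* [Balaban1987RG1] T. Bałaban, *Renormalization group approach to lattice gauge field theories. I*, Commun. Math.
  Phys. 109 (1987) 249–301: (0.31) p. 259 in the tree's per-step normalisation is `Step.Discrete031` (both halves
  `1/g² + b(K−k) ≤ 1/g_k² ≤ 1/g² + β′(K−k)`; locator from that definition's docstring).
Unit `b2b-balaban-pv06` gen 8 (journal CLAIM T4-U5.R-NEC* 2026-08-19T01:00:21Z); the seat is the cell's U5 adversarial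
referee (`t4/T4-REF-U5.md`). [folklore arithmetic]
-/

open Finset _root_.Filter _root_.Topology Asymptotics

namespace Literature.MathematicalPhysics.QuantumFieldTheory.Balaban1983to89.T4BookingNecessity

open T4GoodClassBudget T4RemnantBooking

/-! ## §1 Tools -/

section Tools

/-- Comparison FROM BELOW, eventual form: if `g` is not summable, eventually non-negative and eventually `≤ f`, then
`f` is not summable. [folklore] -/
theorem not_summable_of_eventually_le {f g : ℕ → ℝ} (hg : ¬ Summable g) (h0 : ∀ᶠ n in atTop, 0 ≤ g n)
    (hle : ∀ᶠ n in atTop, g n ≤ f n) : ¬ Summable f := fun hf =>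
  hg (hf.of_norm_bounded_eventually_nat (by
    filter_upwards [h0, hle] with n hn0 hn
    rwa [Real.norm_of_nonneg hn0]))

/-- The shifted p-series: `Σ_K (K+1)^p < ∞ ↔ p < −1`. [folklore] -/
theorem summable_succ_rpow_iff (p : ℝ) :
    Summable (fun K : ℕ => ((K : ℝ) + 1) ^ p) ↔ p < -1 := by
  have e : (fun K : ℕ => ((K : ℝ) + 1) ^ p) = (fun K : ℕ => ((K + 1 : ℕ) : ℝ) ^ p) := by
    funext K; push_cast; rfl
  rw [e]
  exact (summable_nat_add_iff (f := fun n : ℕ => (n : ℝ) ^ p) 1).trans Real.summable_nat_rpow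

/-- `Σ_K (K+1)^{−q} = ∞` for `q ≤ 1`. [folklore] -/
theorem not_summable_succ_rpow_neg {q : ℝ} (hq : q ≤ 1) :
    ¬ Summable (fun K : ℕ => ((K : ℝ) + 1) ^ (-q)) := fun h =>
  absurd ((summable_succ_rpow_iff (-q)).1 h) (by linarith)

/-- A power of a logarithm loses to any linear function, with constants: `A₀·(log(Mx))^{p₀} ≤ c·x` eventually
(`M, c > 0`, any real `A₀`). [folklore] -/
theorem eventually_mul_log_pow_le (A₀ : ℝ) (p₀ : ℕ) {M c : ℝ} (hM : 0 < M) (hc : 0 < c) :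
    ∀ᶠ x : ℝ in atTop, A₀ * Real.log (M * x) ^ p₀ ≤ c * x := by
  have h1 : (fun x : ℝ => Real.log (M * x) ^ p₀) =o[atTop] (fun x : ℝ => M * x) :=
    Real.isLittleO_pow_log_id_atTop.comp_tendsto (tendsto_id.const_mul_atTop hM)
  have h2 : (fun x : ℝ => Real.log (M * x) ^ p₀) =o[atTop] (fun x : ℝ => x) :=
    h1.trans_isBigO (isBigO_const_mul_self M (fun x : ℝ => x) atTop)
  have hA : 0 ≤ |A₀| := abs_nonneg _
  have h3 := h2.def (show (0 : ℝ) < c / (|A₀| + 1) by positivity)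
  filter_upwards [h3, eventually_ge_atTop (0 : ℝ)] with x hx hx0
  rw [Real.norm_eq_abs, Real.norm_eq_abs, abs_of_nonneg hx0] at hx
  calc A₀ * Real.log (M * x) ^ p₀ ≤ |A₀ * Real.log (M * x) ^ p₀| := le_abs_self _
    _ = |A₀| * |Real.log (M * x) ^ p₀| := abs_mul _ _
    _ ≤ |A₀| * (c / (|A₀| + 1) * x) := mul_le_mul_of_nonneg_left hx hA
    _ = (|A₀| / (|A₀| + 1)) * (c * x) := by ring
    _ ≤ 1 * (c * x) :=
        mul_le_mul_of_nonneg_right ((div_le_one (by positivity)).2 (by linarith)) (by positivity)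
    _ = c * x := one_mul _

/-- `log(K+1) → ∞` along `ℕ`. [folklore] -/
theorem tendsto_log_succ_atTop : Tendsto (fun K : ℕ => Real.log ((K : ℝ) + 1)) atTop atTop :=
  Real.tendsto_log_atTop.comp (tendsto_atTop_add_const_right _ _ tendsto_natCast_atTop_atTop)

/-- Eventually the age cut is at most `K` … [folklore] -/
theorem eventually_ageCut_le (C : ℝ) : ∀ᶠ K : ℕ in atTop, ageCut C K ≤ K := by
  have h := (tendsto_atTop_add_const_right _ (1 : ℝ) tendsto_natCast_atTop_atTop).eventually
    (eventually_mul_log_pow_le C 1 one_pos (by norm_num : (0 : ℝ) < 1 / 2))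
  filter_upwards [h, eventually_ge_atTop 1] with K hK hK1
  have hK1' : (1 : ℝ) ≤ K := by exact_mod_cast hK1
  rw [one_mul, pow_one] at hK
  have : C * Real.log ((K : ℝ) + 1) ≤ (K : ℝ) := by linarith
  exact Nat.ceil_le.2 this

/-- … and then the log window `jlogOf C K ≤ j ≤ K` has exactly `ageCut C K + 1` steps. [folklore] -/
theorem sub_jlogOf_eq_ageCut {C : ℝ} {K : ℕ} (h : ageCut C K ≤ K) : K - jlogOf C K = ageCut C K := by
  unfold jlogOf; unfold ageCut at h ⊢; omega

/-- In general the window length is at most the age cut. [folklore] -/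
theorem sub_jlogOf_le_ageCut (C : ℝ) (K : ℕ) : K - jlogOf C K ≤ ageCut C K := by
  unfold jlogOf ageCut; omega

end Tools

/-! ## §2 Window-length factors against a polynomial -/

section Length

/-- A LOGARITHMIC LENGTH FACTOR DOES NOT MOVE A STRICT POLYNOMIAL THRESHOLD:
`Σ_K (C·log(K+1) + 1)·(K+1)^{−q} < ∞ ↔ 1 < q` (`C ≥ 0`). [folklore] -/
theorem summable_logLength_mul_rpow_iff {C : ℝ} (hC : 0 ≤ C) (q : ℝ) :
    Summable (fun K : ℕ => (C * Real.log ((K : ℝ) + 1) + 1) * ((K : ℝ) + 1) ^ (-q)) ↔ 1 < q := by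
  have hlog0 : ∀ K : ℕ, 0 ≤ C * Real.log ((K : ℝ) + 1) := fun K =>
    mul_nonneg hC (Real.log_nonneg (by linarith [(Nat.cast_nonneg K : (0 : ℝ) ≤ K)]))
  constructor
  · intro h
    have h2 : Summable (fun K : ℕ => ((K : ℝ) + 1) ^ (-q)) := by
      refine Summable.of_nonneg_of_le (fun K => by positivity) (fun K => ?_) h
      exact le_mul_of_one_le_left (by positivity) (by linarith [hlog0 K])
    have := (summable_succ_rpow_iff (-q)).1 h2
    linarith
  · intro hq
    have hε0 : 0 < (q - 1) / 2 := div_pos (by linarith) two_pos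
    set ε := (q - 1) / 2 with hε
    have hmaj : Summable (fun K : ℕ => (C / ε + 1) * ((K : ℝ) + 1) ^ (ε - q)) :=
      ((summable_succ_rpow_iff (ε - q)).2 (by rw [hε]; linarith)).mul_left _
    refine Summable.of_nonneg_of_le (fun K => mul_nonneg (by linarith [hlog0 K]) (by positivity))
      (fun K => ?_) hmaj
    have hK : (0 : ℝ) < (K : ℝ) + 1 := by positivity
    have hK1 : (1 : ℝ) ≤ (K : ℝ) + 1 := by linarith [(Nat.cast_nonneg K : (0 : ℝ) ≤ K)]
    have hlog : Real.log ((K : ℝ) + 1) ≤ ((K : ℝ) + 1) ^ ε / ε := Real.log_le_rpow_div hK.le hε0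
    have hp1 : (1 : ℝ) ≤ ((K : ℝ) + 1) ^ ε := Real.one_le_rpow hK1 hε0.le
    have h1 : C * Real.log ((K : ℝ) + 1) + 1 ≤ (C / ε + 1) * ((K : ℝ) + 1) ^ ε := by
      have h3 : C * Real.log ((K : ℝ) + 1) ≤ C * (((K : ℝ) + 1) ^ ε / ε) := mul_le_mul_of_nonneg_left hlog hC
      have e : (C / ε + 1) * ((K : ℝ) + 1) ^ ε = C * (((K : ℝ) + 1) ^ ε / ε) + ((K : ℝ) + 1) ^ ε := by ring
      rw [e]
      linarith
    calc (C * Real.log ((K : ℝ) + 1) + 1) * ((K : ℝ) + 1) ^ (-q)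
        ≤ ((C / ε + 1) * ((K : ℝ) + 1) ^ ε) * ((K : ℝ) + 1) ^ (-q) :=
          mul_le_mul_of_nonneg_right h1 (by positivity)
      _ = (C / ε + 1) * ((K : ℝ) + 1) ^ (ε - q) := by
          rw [mul_assoc, ← Real.rpow_add hK, ← sub_eq_add_neg]

/-- … BUT A LINEAR ONE DOES: the exact converse of `T4Crossover.summable_succ_mul_inv_rpow` (the crude count of the
OLD scales in crossover lemma (ii)): `Σ_K (K+1)·(c(K+1))^{−p} < ∞ ↔ 2 < p` (`c > 0`). [folklore] -/
theorem summable_succ_mul_inv_rpow_iff {c : ℝ} (hc : 0 < c) (p : ℝ) :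
    Summable (fun K : ℕ => ((K : ℝ) + 1) * (c * ((K : ℝ) + 1))⁻¹ ^ p) ↔ 2 < p := by
  have e : ∀ K : ℕ, ((K : ℝ) + 1) * (c * ((K : ℝ) + 1))⁻¹ ^ p = c⁻¹ ^ p * ((K : ℝ) + 1) ^ (1 - p) :=
    fun K => by
      have hK : 0 < (K : ℝ) + 1 := by positivity
      rw [mul_inv, Real.mul_rpow (inv_nonneg.mpr hc.le) (inv_nonneg.mpr hK.le), Real.inv_rpow hK.le,
        Real.rpow_sub hK, Real.rpow_one]
      field_simp
  simp_rw [e]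
  rw [summable_mul_left_iff (by positivity : c⁻¹ ^ p ≠ 0), summable_succ_rpow_iff]
  constructor <;> intro h <;> linarith

end Length

/-! ## §3 The exact old-remnant threshold -/

section Threshold

/-- `(K+1)^{C·log Λ} ≤ Λ^{ageCut C K}` for `Λ ≥ 1`. [folklore] -/
theorem rpow_le_pow_ageCut {Λ : ℝ} (hΛ : 1 ≤ Λ) (C : ℝ) (K : ℕ) :
    ((K : ℝ) + 1) ^ (C * Real.log Λ) ≤ Λ ^ ageCut C K := by
  have hΛ0 : 0 < Λ := one_pos.trans_le hΛ
  rw [← rpow_log_swap hΛ0, ← Real.rpow_natCast]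
  exact Real.rpow_le_rpow_of_exponent_le hΛ (Nat.le_ceil _)

/-- `Λ^{ageCut C K} ≤ Λ·(K+1)^{C·log Λ}` for `Λ ≥ 1`, `C ≥ 0`. [folklore] -/
theorem pow_ageCut_le_mul_rpow {Λ C : ℝ} (hΛ : 1 ≤ Λ) (hC : 0 ≤ C) (K : ℕ) :
    Λ ^ ageCut C K ≤ Λ * ((K : ℝ) + 1) ^ (C * Real.log Λ) := by
  have hΛ0 : 0 < Λ := one_pos.trans_le hΛ
  have hx : 0 ≤ C * Real.log ((K : ℝ) + 1) :=
    mul_nonneg hC (Real.log_nonneg (by linarith [(Nat.cast_nonneg K : (0 : ℝ) ≤ K)]))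
  calc Λ ^ ageCut C K = Λ ^ ((ageCut C K : ℕ) : ℝ) := (Real.rpow_natCast _ _).symm
    _ ≤ Λ ^ (C * Real.log ((K : ℝ) + 1) + 1) :=
        Real.rpow_le_rpow_of_exponent_le hΛ (Nat.ceil_lt_add_one hx).le
    _ = Λ * ((K : ℝ) + 1) ^ (C * Real.log Λ) := by
        rw [Real.rpow_add hΛ0, Real.rpow_one, rpow_log_swap hΛ0, mul_comm]

/-- `ρ^{ageCut C′ K} ≤ (K+1)^{C′·log ρ}` for `0 < ρ ≤ 1` (the statement of `T4RemnantBooking.pow_ageCut_le` with the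
exponent written `C′·log ρ`). [folklore] -/
theorem pow_ageCut_le_rpow {ρ : ℝ} (h0 : 0 < ρ) (h1 : ρ ≤ 1) (C' : ℝ) (K : ℕ) :
    ρ ^ ageCut C' K ≤ ((K : ℝ) + 1) ^ (C' * Real.log ρ) := by
  rw [← rpow_log_swap h0, ← Real.rpow_natCast]
  exact Real.rpow_le_rpow_of_exponent_ge h0 h1 (Nat.le_ceil _)

/-- `ρ·(K+1)^{C′·log ρ} ≤ ρ^{ageCut C′ K}` for `0 < ρ ≤ 1`, `C′ ≥ 0`. [folklore] -/
theorem mul_rpow_le_pow_ageCut {ρ C' : ℝ} (h0 : 0 < ρ) (h1 : ρ ≤ 1) (hC' : 0 ≤ C') (K : ℕ) :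
    ρ * ((K : ℝ) + 1) ^ (C' * Real.log ρ) ≤ ρ ^ ageCut C' K := by
  have hx : 0 ≤ C' * Real.log ((K : ℝ) + 1) :=
    mul_nonneg hC' (Real.log_nonneg (by linarith [(Nat.cast_nonneg K : (0 : ℝ) ≤ K)]))
  calc ρ * ((K : ℝ) + 1) ^ (C' * Real.log ρ) = ρ ^ (C' * Real.log ((K : ℝ) + 1) + 1) := by
        rw [Real.rpow_add h0, Real.rpow_one, rpow_log_swap h0, mul_comm]
    _ ≤ ρ ^ ((ageCut C' K : ℕ) : ℝ) := Real.rpow_le_rpow_of_exponent_ge h0 h1 (Nat.ceil_lt_add_one hx).le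
    _ = ρ ^ ageCut C' K := Real.rpow_natCast _ _

/-- **THE EXACT THRESHOLD** (referee report `t4/T4-REF-U5.md` F2 [v1.1 P3], kernel form): for `0 < ρ < 1 ≤ Λ` and
`C, C′ ≥ 0`, the top-of-window count `Λ^{⌈C·log(K+1)⌉}` against the age gain `ρ^{⌈C′·log(K+1)⌉}` is summable in `K`
IF AND ONLY IF `1 < C′(−log ρ) − C·log Λ` (both factors are `(K+1)`-powers up to the constants `Λ`, `ρ`).
`T4RemnantBooking.summable_remnantOld_logWindow` assumes the stronger `⌈C·log Λ⌉ + 3 ≤ C′(−log ρ)`. [folklore] -/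
theorem summable_pow_ageCut_mul_iff {Λ ρ C C' : ℝ} (hΛ : 1 ≤ Λ) (hC : 0 ≤ C) (h0 : 0 < ρ) (h1 : ρ < 1)
    (hC' : 0 ≤ C') :
    Summable (fun K : ℕ => Λ ^ ageCut C K * ρ ^ ageCut C' K) ↔ 1 < C' * (-Real.log ρ) - C * Real.log Λ := by
  have hΛ0 : 0 < Λ := one_pos.trans_le hΛ
  set s := C * Real.log Λ + C' * Real.log ρ with hs
  have hiff : Summable (fun K : ℕ => ((K : ℝ) + 1) ^ s) ↔ 1 < C' * (-Real.log ρ) - C * Real.log Λ := by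
    rw [summable_succ_rpow_iff]
    constructor <;> intro h <;> linarith
  rw [← hiff]
  have hsplit : ∀ K : ℕ, ((K : ℝ) + 1) ^ s =
      ((K : ℝ) + 1) ^ (C * Real.log Λ) * ((K : ℝ) + 1) ^ (C' * Real.log ρ) :=
    fun K => Real.rpow_add (by positivity) _ _
  have hlo : ∀ K : ℕ, ρ * ((K : ℝ) + 1) ^ s ≤ Λ ^ ageCut C K * ρ ^ ageCut C' K := fun K => by
    calc ρ * ((K : ℝ) + 1) ^ s
        = ((K : ℝ) + 1) ^ (C * Real.log Λ) * (ρ * ((K : ℝ) + 1) ^ (C' * Real.log ρ)) := by rw [hsplit]; ring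
      _ ≤ Λ ^ ageCut C K * ρ ^ ageCut C' K :=
          mul_le_mul (rpow_le_pow_ageCut hΛ C K) (mul_rpow_le_pow_ageCut h0 h1.le hC' K) (by positivity)
            (by positivity)
  have hhi : ∀ K : ℕ, Λ ^ ageCut C K * ρ ^ ageCut C' K ≤ Λ * ((K : ℝ) + 1) ^ s := fun K => by
    calc Λ ^ ageCut C K * ρ ^ ageCut C' K
        ≤ (Λ * ((K : ℝ) + 1) ^ (C * Real.log Λ)) * ((K : ℝ) + 1) ^ (C' * Real.log ρ) :=
          mul_le_mul (pow_ageCut_le_mul_rpow hΛ hC K) (pow_ageCut_le_rpow h0 h1.le C' K) (by positivity)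
            (by positivity)
      _ = Λ * ((K : ℝ) + 1) ^ s := by rw [hsplit]; ring
  constructor
  · intro h
    have h2 : Summable (fun K : ℕ => ρ * ((K : ℝ) + 1) ^ s) :=
      Summable.of_nonneg_of_le (fun K => by positivity) hlo h
    exact (summable_mul_left_iff h0.ne').1 h2
  · intro h
    exact Summable.of_nonneg_of_le (fun K => by positivity) hhi (h.mul_left Λ)

/-- The pre-summed instance `Λ := 1` (the referee's per-unit-FINAL-volume accounting, `t4/T4-REF-U5.md` (0.2)):
`Σ_K ρ^{⌈C′·log(K+1)⌉} < ∞ ↔ 1 < C′(−log ρ)` — in the referee's words (cell record, not print): a geometric gain per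
event over logarithmically many events is a power of `K`, summable iff the power exceeds one. [folklore] -/
theorem summable_pow_ageCut_iff {ρ C' : ℝ} (h0 : 0 < ρ) (h1 : ρ < 1) (hC' : 0 ≤ C') :
    Summable (fun K : ℕ => ρ ^ ageCut C' K) ↔ 1 < C' * (-Real.log ρ) := by
  simpa using summable_pow_ageCut_mul_iff (Λ := 1) (C := 0) le_rfl le_rfl h0 h1 hC'

/-- **SHARP SUFFICIENCY in the shape of `T4RemnantBooking.summable_remnantOld_logWindow`**: under the hypothesis
shape `RemnantAgeBound remOld E₀ ρ` (cell NE7b-rem, NOT PRINTED) the old-born remnant window sum is summable in `K`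
as soon as `1 < C′(−log ρ) − C·log Λ` (that lemma asks `⌈C·log Λ⌉ + 3 ≤ C′(−log ρ)`).  Proof: window sum
`≤ E₀ρ^{A(K)}·(length)·Λ^{K − jlog(K)} ≤ E₀·(C·log(K+1)+2)·Λ·(K+1)^{C log Λ + C′ log ρ}`, and a logarithmic length
factor does not move a strict threshold (§2). [folklore] -/
theorem summable_remnantOld_logWindow_sharp {Λ C C' E₀ ρ : ℝ} {remOld : ℕ → ℕ → ℝ} (hΛ : 1 ≤ Λ) (hC : 0 ≤ C)
    (hE : 0 ≤ E₀) (h0 : 0 < ρ) (h1 : ρ < 1) (h : RemnantAgeBound remOld E₀ ρ)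
    (hq : 1 < C' * (-Real.log ρ) - C * Real.log Λ) :
    Summable (fun K => ∑ j ∈ Icc (jlogOf C K) K, Λ ^ (K - j) * remOld j (ageCut C' K)) := by
  have hΛ0 : 0 < Λ := one_pos.trans_le hΛ
  set q := C' * (-Real.log ρ) - C * Real.log Λ with hqdef
  have hmaj : Summable (fun K : ℕ =>
      (2 * E₀ * Λ) * ((C * Real.log ((K : ℝ) + 1) + 1) * ((K : ℝ) + 1) ^ (-q))) :=
    ((summable_logLength_mul_rpow_iff hC q).2 hq).mul_left _
  refine Summable.of_nonneg_of_le (fun K => Finset.sum_nonneg fun j _ =>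
    mul_nonneg (pow_nonneg hΛ0.le _) (h j _).1) (fun K => ?_) hmaj
  have hK : (0 : ℝ) < (K : ℝ) + 1 := by positivity
  have hx0 : 0 ≤ C * Real.log ((K : ℝ) + 1) :=
    mul_nonneg hC (Real.log_nonneg (by linarith [(Nat.cast_nonneg K : (0 : ℝ) ≤ K)]))
  -- Step 1: the sum is at most `E₀ ρ^{A(K)} · windowSum 1 Λ jlog K`.
  have hs1 : ∑ j ∈ Icc (jlogOf C K) K, Λ ^ (K - j) * remOld j (ageCut C' K) ≤
      E₀ * ρ ^ ageCut C' K * windowSum 1 Λ (jlogOf C K) K := by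
    unfold windowSum
    rw [Finset.mul_sum]
    refine Finset.sum_le_sum fun j _ => ?_
    calc Λ ^ (K - j) * remOld j (ageCut C' K) ≤ Λ ^ (K - j) * (E₀ * ρ ^ ageCut C' K) :=
          mul_le_mul_of_nonneg_left (h j _).2 (pow_nonneg hΛ0.le _)
      _ = E₀ * ρ ^ ageCut C' K * ((1 : ℝ) ^ j * Λ ^ (K - j)) := by rw [one_pow, one_mul]; ring
  -- Step 2: the window sum is at most its length times its top term.
  have hs2 : windowSum 1 Λ (jlogOf C K) K ≤ (C * Real.log ((K : ℝ) + 1) + 2) * (Λ * ((K : ℝ) + 1) ^ (C * Real.log Λ)) := by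
    have hlen := windowSum_le_length (θ := (1 : ℝ)) zero_le_one le_rfl hΛ (jlogOf_le C K)
    rw [one_pow, one_mul] at hlen
    refine hlen.trans (mul_le_mul ?_ ?_ (pow_nonneg hΛ0.le _) (by linarith))
    · linarith [sub_jlogOf_le hC K]
    · exact (pow_le_pow_right₀ hΛ (sub_jlogOf_le_ageCut C K)).trans (pow_ageCut_le_mul_rpow hΛ hC K)
  -- Step 3: the age gain is a power.
  have hs3 : ρ ^ ageCut C' K ≤ ((K : ℝ) + 1) ^ (C' * Real.log ρ) := pow_ageCut_le_rpow h0 h1.le C' K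
  -- Step 4: assemble the powers.
  have hpow : ((K : ℝ) + 1) ^ (C' * Real.log ρ) * ((K : ℝ) + 1) ^ (C * Real.log Λ) = ((K : ℝ) + 1) ^ (-q) := by
    rw [← Real.rpow_add hK]; congr 1; rw [hqdef]; ring
  calc ∑ j ∈ Icc (jlogOf C K) K, Λ ^ (K - j) * remOld j (ageCut C' K)
      ≤ E₀ * ρ ^ ageCut C' K * windowSum 1 Λ (jlogOf C K) K := hs1
    _ ≤ E₀ * ((K : ℝ) + 1) ^ (C' * Real.log ρ) *
          ((C * Real.log ((K : ℝ) + 1) + 2) * (Λ * ((K : ℝ) + 1) ^ (C * Real.log Λ))) :=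
        mul_le_mul (mul_le_mul_of_nonneg_left hs3 hE) hs2 (windowSum_nonneg zero_le_one hΛ0.le _ _)
          (by positivity)
    _ = E₀ * Λ * (C * Real.log ((K : ℝ) + 1) + 2) *
          (((K : ℝ) + 1) ^ (C' * Real.log ρ) * ((K : ℝ) + 1) ^ (C * Real.log Λ)) := by ring
    _ = E₀ * Λ * (C * Real.log ((K : ℝ) + 1) + 2) * ((K : ℝ) + 1) ^ (-q) := by rw [hpow]
    _ ≤ (2 * E₀ * Λ) * ((C * Real.log ((K : ℝ) + 1) + 1) * ((K : ℝ) + 1) ^ (-q)) := by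
        have : C * Real.log ((K : ℝ) + 1) + 2 ≤ 2 * (C * Real.log ((K : ℝ) + 1) + 1) := by linarith
        have hEΛ : 0 ≤ E₀ * Λ := mul_nonneg hE hΛ0.le
        nlinarith [mul_nonneg hEΛ (Real.rpow_nonneg hK.le (-q)), Real.rpow_nonneg hK.le (-q)]

/-- **NECESSITY under saturation**: if the hypothesis shape is SATURATED, `remOld j A = E₀ρ^A` with `E₀ > 0` (nothing
better than the per-event gain is available), then summability of the old-born window sum FORCES
`1 < C′(−log ρ) − C·log Λ` (the `j = jlog(K)` term alone is `E₀ρ^{A(K)}Λ^{ageCut C K}` eventually). [folklore] -/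
theorem one_lt_of_summable_remnantOld_saturated {Λ C C' E₀ ρ : ℝ} {remOld : ℕ → ℕ → ℝ} (hΛ : 1 ≤ Λ) (hC : 0 ≤ C)
    (hE : 0 < E₀) (h0 : 0 < ρ) (h1 : ρ < 1) (hC' : 0 ≤ C') (hsat : ∀ j A, remOld j A = E₀ * ρ ^ A)
    (hsum : Summable (fun K => ∑ j ∈ Icc (jlogOf C K) K, Λ ^ (K - j) * remOld j (ageCut C' K))) :
    1 < C' * (-Real.log ρ) - C * Real.log Λ := by
  have hΛ0 : 0 < Λ := one_pos.trans_le hΛ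
  rw [← summable_pow_ageCut_mul_iff hΛ hC h0 h1 hC']
  refine (hsum.mul_left E₀⁻¹).of_norm_bounded_eventually_nat ?_
  filter_upwards [eventually_ageCut_le C] with K hK
  rw [Real.norm_of_nonneg (by positivity)]
  have hmem : jlogOf C K ∈ Icc (jlogOf C K) K := Finset.mem_Icc.2 ⟨le_rfl, jlogOf_le C K⟩
  have hterm : Λ ^ (K - jlogOf C K) * remOld (jlogOf C K) (ageCut C' K) ≤
      ∑ j ∈ Icc (jlogOf C K) K, Λ ^ (K - j) * remOld j (ageCut C' K) :=
    Finset.single_le_sum (f := fun j => Λ ^ (K - j) * remOld j (ageCut C' K))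
      (fun j _ => mul_nonneg (pow_nonneg hΛ0.le _) (by rw [hsat]; positivity)) hmem
  rw [sub_jlogOf_eq_ageCut hK, hsat] at hterm
  calc Λ ^ ageCut C K * ρ ^ ageCut C' K = E₀⁻¹ * (Λ ^ ageCut C K * (E₀ * ρ ^ ageCut C' K)) := by
        field_simp
    _ ≤ E₀⁻¹ * ∑ j ∈ Icc (jlogOf C K) K, Λ ^ (K - j) * remOld j (ageCut C' K) :=
        mul_le_mul_of_nonneg_left hterm (inv_nonneg.2 hE.le)

/-- The two directions together: for a SATURATED hypothesis shape the old-born remnant booking of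
`T4RemnantBooking` is summable IF AND ONLY IF `1 < C′(−log ρ) − C·log Λ`. [folklore] -/
theorem summable_remnantOld_logWindow_iff_of_saturated {Λ C C' E₀ ρ : ℝ} {remOld : ℕ → ℕ → ℝ} (hΛ : 1 ≤ Λ)
    (hC : 0 ≤ C) (hE : 0 < E₀) (h0 : 0 < ρ) (h1 : ρ < 1) (hC' : 0 ≤ C')
    (hsat : ∀ j A, remOld j A = E₀ * ρ ^ A) :
    Summable (fun K => ∑ j ∈ Icc (jlogOf C K) K, Λ ^ (K - j) * remOld j (ageCut C' K)) ↔
      1 < C' * (-Real.log ρ) - C * Real.log Λ :=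
  ⟨one_lt_of_summable_remnantOld_saturated hΛ hC hE h0 h1 hC' hsat,
    summable_remnantOld_logWindow_sharp hΛ hC hE.le h0 h1
      (fun j A => ⟨by rw [hsat]; positivity, (hsat j A).le⟩)⟩

/-- BANK FORM (the re-parametrisation of `T4RemnantBooking.summable_remnantOld_logWindow_bank`, `ρ = e^{−c}`,
`c > 0`): the old-born booking is summable as soon as `1 < C′·c − C·log Λ` (that lemma asks `⌈C·log Λ⌉ + 3 ≤ C′·c`).
[folklore] -/
theorem summable_remnantOld_logWindow_bank_sharp {Λ C C' E₀ c : ℝ} {remOld : ℕ → ℕ → ℝ} (hΛ : 1 ≤ Λ)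
    (hC : 0 ≤ C) (hE : 0 ≤ E₀) (hc : 0 < c)
    (h : ∀ j A : ℕ, 0 ≤ remOld j A ∧ remOld j A ≤ E₀ * Real.exp (-(c * A))) (hq : 1 < C' * c - C * Real.log Λ) :
    Summable (fun K => ∑ j ∈ Icc (jlogOf C K) K, Λ ^ (K - j) * remOld j (ageCut C' K)) := by
  have hρ1 : Real.exp (-c) < 1 := Real.exp_lt_one_iff.2 (by linarith)
  have hshape : RemnantAgeBound remOld E₀ (Real.exp (-c)) := fun j A => by
    obtain ⟨h0, h1⟩ := h j A
    refine ⟨h0, ?_⟩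
    have e : Real.exp (-(c * (A : ℝ))) = Real.exp (-c) ^ A := by
      rw [← Real.exp_nat_mul]; congr 1; ring
    rwa [e] at h1
  exact summable_remnantOld_logWindow_sharp hΛ hC hE (Real.exp_pos _) hρ1 hshape
    (by rwa [Real.log_exp, neg_neg])

end Threshold

/-! ## §4 No size-only booking inside the log window along asymptotic freedom -/

section NoSizeOnly

/-- Under the LOWER half of `Step.Discrete031` with `b ≥ 0` and an endpoint `0 < g ≤ 1`, every coupling on the
trajectory is at most one: `1 ≤ 1/g_j²`. [folklore] -/
theorem one_le_inv_sq {b β' g : ℝ} {K : ℕ} {gs : ℕ → ℝ} (hb : 0 ≤ b) (hg : 0 < g) (hg1 : g ≤ 1)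
    (h031 : Step.Discrete031 b β' K g gs) {j : ℕ} (hj : j ≤ K) : 1 ≤ 1 / gs j ^ 2 := by
  have h1 : (1 : ℝ) ≤ 1 / g ^ 2 := by
    rw [le_div_iff₀ (pow_pos hg 2), one_mul]
    exact pow_le_one₀ hg.le hg1
  have h2 : 0 ≤ b * ((K : ℝ) - j) := mul_nonneg hb (sub_nonneg.2 (by exact_mod_cast hj))
  linarith [(h031 j hj).1]

/-- Under the UPPER half of `Step.Discrete031` (`β′ ≥ 0`) the couplings on the log window obey
`1/g_j² ≤ 1/g² + β′(C·log(K+1) + 1)`. [folklore] -/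
theorem inv_sq_le_logWindow {b β' g C : ℝ} {K : ℕ} {gs : ℕ → ℝ} (hβ : 0 ≤ β') (hC : 0 ≤ C)
    (h031 : Step.Discrete031 b β' K g gs) {j : ℕ} (hj1 : jlogOf C K ≤ j) (hj2 : j ≤ K) :
    1 / gs j ^ 2 ≤ 1 / g ^ 2 + β' * (C * Real.log ((K : ℝ) + 1) + 1) := by
  have h1 : (K : ℝ) - j ≤ C * Real.log ((K : ℝ) + 1) + 1 := by
    have e : (K : ℝ) - j = ((K - j : ℕ) : ℝ) := (Nat.cast_sub hj2).symm
    have h2 : ((K - j : ℕ) : ℝ) ≤ ((K - jlogOf C K : ℕ) : ℝ) := by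
      exact_mod_cast (by omega : K - j ≤ K - jlogOf C K)
    rw [e]
    exact h2.trans (sub_jlogOf_le hC K)
  exact (h031 j hj2).2.trans (by linarith [mul_le_mul_of_nonneg_left h1 hβ])

variable {b β' g C : ℝ} {gs : ℕ → ℕ → ℝ}

/-- THE WINDOW COUPLINGS ARE LOGARITHMICALLY CONTROLLED: under the two-sided endpoint running (one `Step.Discrete031`
per number of steps `K`, endpoint `g_K = g ∈ ]0,1]`, `b, β′ ≥ 0`), eventually in `K` and for every `j` in the log
window, `1 ≤ 1/g_j² ≤ (1/g² + β′(C+1))·log(K+1)`. [folklore] -/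
theorem eventually_inv_sq_le_mul_log (hb : 0 ≤ b) (hβ : 0 ≤ β') (hg : 0 < g) (hg1 : g ≤ 1) (hC : 0 ≤ C)
    (h031 : ∀ K, Step.Discrete031 b β' K g (gs K)) :
    ∀ᶠ K : ℕ in atTop, ∀ j, jlogOf C K ≤ j → j ≤ K →
      1 ≤ 1 / gs K j ^ 2 ∧ 1 / gs K j ^ 2 ≤ (1 / g ^ 2 + β' * (C + 1)) * Real.log ((K : ℝ) + 1) := by
  filter_upwards [tendsto_log_succ_atTop.eventually (eventually_ge_atTop (1 : ℝ))] with K hK j hj1 hj2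
  refine ⟨one_le_inv_sq hb hg hg1 (h031 K) hj2, (inv_sq_le_logWindow hβ hC (h031 K) hj1 hj2).trans ?_⟩
  have h1 : 1 / g ^ 2 ≤ 1 / g ^ 2 * Real.log ((K : ℝ) + 1) := le_mul_of_one_le_right (by positivity) hK
  have h2 : β' * (C * Real.log ((K : ℝ) + 1) + 1) ≤ β' * (C * Real.log ((K : ℝ) + 1) + Real.log ((K : ℝ) + 1)) :=
    mul_le_mul_of_nonneg_left (by linarith) hβ
  have e : (1 / g ^ 2 + β' * (C + 1)) * Real.log ((K : ℝ) + 1) =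
      1 / g ^ 2 * Real.log ((K : ℝ) + 1) + β' * (C * Real.log ((K : ℝ) + 1) + Real.log ((K : ℝ) + 1)) := by ring
  rw [e]
  linarith

/-- **NO SIZE-ONLY BOOKING, exponential sizes** (`t4/T4-REF-U5.md` F2 (a)): with the tree's profile
`p0Profile A₀ p₀ g = A₀(log g⁻²)^{p₀}` (`A₀ ≥ 0`), for EVERY `q > 0`, eventually in `K` and uniformly on the log
window, `(K+1)^{−q} ≤ exp(−p₀(g_j))` — the one-run size `e^{−p₀(g_j)}` of the step-`j` remnants ((1.100) p. 390)
decays slower than any power of `K` there. [folklore] -/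
theorem eventually_rpow_neg_le_exp_neg_p0Profile {A₀ : ℝ} (hA : 0 ≤ A₀) (p₀ : ℕ) (hb : 0 ≤ b) (hβ : 0 ≤ β')
    (hg : 0 < g) (hg1 : g ≤ 1) (hC : 0 ≤ C) {q : ℝ} (hq : 0 < q)
    (h031 : ∀ K, Step.Discrete031 b β' K g (gs K)) :
    ∀ᶠ K : ℕ in atTop, ∀ j, jlogOf C K ≤ j → j ≤ K →
      ((K : ℝ) + 1) ^ (-q) ≤ Real.exp (-(p0Profile A₀ p₀ (gs K j))) := by
  have hM : 0 < 1 / g ^ 2 + β' * (C + 1) := by positivity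
  filter_upwards [eventually_inv_sq_le_mul_log hb hβ hg hg1 hC h031,
    tendsto_log_succ_atTop.eventually (eventually_mul_log_pow_le A₀ p₀ hM hq)] with K hK hK' j hj1 hj2
  obtain ⟨hu1, hu2⟩ := hK j hj1 hj2
  have hu0 : 0 < 1 / gs K j ^ 2 := one_pos.trans_le hu1
  have hlog0 : 0 ≤ Real.log (1 / gs K j ^ 2) := Real.log_nonneg hu1
  have hlog1 : Real.log (1 / gs K j ^ 2) ≤
      Real.log ((1 / g ^ 2 + β' * (C + 1)) * Real.log ((K : ℝ) + 1)) := Real.log_le_log hu0 hu2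
  have hprof : p0Profile A₀ p₀ (gs K j) ≤ q * Real.log ((K : ℝ) + 1) := by
    unfold p0Profile
    rw [inv_eq_one_div]
    exact (mul_le_mul_of_nonneg_left (pow_le_pow_left₀ hlog0 hlog1 p₀) hA).trans hK'
  rw [Real.rpow_def_of_pos (by positivity)]
  exact Real.exp_le_exp.2 (by linarith)

/-- **NO SIZE-ONLY BOOKING, polynomial sizes**: for EVERY `q > 0` and every `κ₀`, eventually in `K` and uniformly on
the log window, `(K+1)^{−q} ≤ g_j^{κ₀}` (positive couplings) — the `g_j^{κ₀}`-smallness of `T4Crossover` decays slower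
than any power of `K` on the RECENT scales (there it is the rate `θ^j`, not the size, that books the term:
`T4Crossover.min_le_of_remaining_le`). [folklore] -/
theorem eventually_rpow_neg_le_pow (hb : 0 ≤ b) (hβ : 0 ≤ β') (hg : 0 < g) (hg1 : g ≤ 1) (hC : 0 ≤ C)
    {q : ℝ} (hq : 0 < q) (h031 : ∀ K, Step.Discrete031 b β' K g (gs K))
    (hpos : ∀ K j, j ≤ K → 0 < gs K j) (κ₀ : ℕ) :
    ∀ᶠ K : ℕ in atTop, ∀ j, jlogOf C K ≤ j → j ≤ K → ((K : ℝ) + 1) ^ (-q) ≤ gs K j ^ κ₀ := by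
  have hM : 0 < 1 / g ^ 2 + β' * (C + 1) := by positivity
  have hq' : 0 < q / ((κ₀ : ℝ) + 1) := by positivity
  filter_upwards [eventually_inv_sq_le_mul_log hb hβ hg hg1 hC h031,
    tendsto_log_succ_atTop.eventually (eventually_mul_log_pow_le 1 1 hM hq')] with K hK hK' j hj1 hj2
  obtain ⟨hu1, hu2⟩ := hK j hj1 hj2
  set x := Real.log ((K : ℝ) + 1) with hxdef
  set U := (1 / g ^ 2 + β' * (C + 1)) * x with hUdef
  have hgp : 0 < gs K j := hpos K j hj2
  have hu0 : 0 < 1 / gs K j ^ 2 := one_pos.trans_le hu1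
  have hU1 : 1 ≤ U := hu1.trans hu2
  have hU0 : 0 < U := one_pos.trans_le hU1
  have hx0 : 0 ≤ x := Real.log_nonneg (by linarith [(Nat.cast_nonneg K : (0 : ℝ) ≤ K)])
  have hsq : U⁻¹ ≤ gs K j ^ 2 := by
    rw [inv_le_comm₀ hU0 (pow_pos hgp 2), inv_eq_one_div]
    exact hu2
  have hlogU : Real.log U ≤ q / ((κ₀ : ℝ) + 1) * x := by
    have := hK'
    rwa [one_mul, pow_one] at this
  have hlogU0 : 0 ≤ Real.log U := Real.log_nonneg hU1
  have hk : (κ₀ : ℝ) / 2 * Real.log U ≤ q * x :=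
    calc (κ₀ : ℝ) / 2 * Real.log U ≤ (κ₀ : ℝ) * Real.log U :=
          mul_le_mul_of_nonneg_right (half_le_self (Nat.cast_nonneg _)) hlogU0
      _ ≤ (κ₀ : ℝ) * (q / ((κ₀ : ℝ) + 1) * x) := mul_le_mul_of_nonneg_left hlogU (Nat.cast_nonneg _)
      _ = (κ₀ : ℝ) / ((κ₀ : ℝ) + 1) * (q * x) := by ring
      _ ≤ q * x :=
          mul_le_of_le_one_left (mul_nonneg hq.le hx0) ((div_le_one (by positivity)).2 (by linarith))
  have e1 : gs K j ^ κ₀ = (gs K j ^ 2) ^ ((κ₀ : ℝ) / 2) := by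
    rw [← Real.rpow_natCast (gs K j) κ₀, ← Real.rpow_natCast (gs K j) 2, ← Real.rpow_mul hgp.le]
    congr 1
    push_cast
    ring
  rw [e1, Real.rpow_def_of_pos (by positivity : (0 : ℝ) < (K : ℝ) + 1)]
  calc Real.exp (Real.log ((K : ℝ) + 1) * -q) ≤ Real.exp (Real.log U⁻¹ * ((κ₀ : ℝ) / 2)) := by
        refine Real.exp_le_exp.2 ?_
        rw [Real.log_inv, ← hxdef]
        linarith
    _ = U⁻¹ ^ ((κ₀ : ℝ) / 2) := (Real.rpow_def_of_pos (inv_pos.2 hU0) _).symm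
    _ ≤ (gs K j ^ 2) ^ ((κ₀ : ℝ) / 2) := Real.rpow_le_rpow (inv_nonneg.2 hU0.le) hsq (by positivity)

/-- COROLLARY (exponential sizes): NO per-`K` SELECTION of window terms `m_K·e^{−p₀(g_{j(K)})}` with multiplicities
`m_K ≥ 1` (e.g. the cube counts `Λ^{K−j} ≥ 1`) is summable in `K`.  A rate or an age-resolved gain is indispensable on
the window (`T4RemnantBooking`, §3 above). [folklore] -/
theorem not_summable_exp_neg_p0Profile_select {A₀ : ℝ} (hA : 0 ≤ A₀) (p₀ : ℕ) (hb : 0 ≤ b) (hβ : 0 ≤ β')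
    (hg : 0 < g) (hg1 : g ≤ 1) (hC : 0 ≤ C) (h031 : ∀ K, Step.Discrete031 b β' K g (gs K))
    {sel : ℕ → ℕ} (hsel : ∀ K, jlogOf C K ≤ sel K ∧ sel K ≤ K) {m : ℕ → ℝ} (hm : ∀ K, 1 ≤ m K) :
    ¬ Summable (fun K => m K * Real.exp (-(p0Profile A₀ p₀ (gs K (sel K))))) := by
  refine not_summable_of_eventually_le (not_summable_succ_rpow_neg le_rfl)
    (Eventually.of_forall fun K => by positivity) ?_
  filter_upwards [eventually_rpow_neg_le_exp_neg_p0Profile hA p₀ hb hβ hg hg1 hC one_pos h031] with K hK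
  calc ((K : ℝ) + 1) ^ (-(1 : ℝ)) ≤ Real.exp (-(p0Profile A₀ p₀ (gs K (sel K)))) := hK _ (hsel K).1 (hsel K).2
    _ = 1 * Real.exp (-(p0Profile A₀ p₀ (gs K (sel K)))) := (one_mul _).symm
    _ ≤ m K * Real.exp (-(p0Profile A₀ p₀ (gs K (sel K)))) :=
        mul_le_mul_of_nonneg_right (hm K) (Real.exp_nonneg _)

/-- COROLLARY (polynomial sizes): no per-`K` selection of window terms `m_K·g_{j(K)}^{κ₀}` with `m_K ≥ 1` is summable
in `K`. [folklore] -/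
theorem not_summable_pow_select (hb : 0 ≤ b) (hβ : 0 ≤ β') (hg : 0 < g) (hg1 : g ≤ 1) (hC : 0 ≤ C)
    (h031 : ∀ K, Step.Discrete031 b β' K g (gs K)) (hpos : ∀ K j, j ≤ K → 0 < gs K j) (κ₀ : ℕ)
    {sel : ℕ → ℕ} (hsel : ∀ K, jlogOf C K ≤ sel K ∧ sel K ≤ K) {m : ℕ → ℝ} (hm : ∀ K, 1 ≤ m K) :
    ¬ Summable (fun K => m K * gs K (sel K) ^ κ₀) := by
  refine not_summable_of_eventually_le (not_summable_succ_rpow_neg le_rfl)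
    (Eventually.of_forall fun K => by positivity) ?_
  filter_upwards [eventually_rpow_neg_le_pow hb hβ hg hg1 hC one_pos h031 hpos κ₀] with K hK
  calc ((K : ℝ) + 1) ^ (-(1 : ℝ)) ≤ gs K (sel K) ^ κ₀ := hK _ (hsel K).1 (hsel K).2
    _ = 1 * gs K (sel K) ^ κ₀ := (one_mul _).symm
    _ ≤ m K * gs K (sel K) ^ κ₀ :=
        mul_le_mul_of_nonneg_right (hm K) (pow_nonneg (hpos K _ (hsel K).2).le _)

end NoSizeOnly

/-! ## §5 The recent-rate coefficient -/

section RecentRate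

/-- **THE RECENT-RATE THRESHOLD** of crossover lemma (ii) (`T4Crossover.min_le_of_remaining_le`): for `θ, Λ > 0`
and any real `σ`, `Σ_K (θ(Λ/θ)^σ)^K < ∞ ↔ σ·log(Λ/θ) < log θ⁻¹`; for `θ < Λ` this is `σ < log θ⁻¹ / log(Λ/θ)`
(`T4Crossover.exists_recentRate_lt_one` picks `σ` at half that value). [folklore] -/
theorem summable_recentRate_pow_iff {θ Λ : ℝ} (hθ : 0 < θ) (hΛ : 0 < Λ) (σ : ℝ) :
    Summable (fun K : ℕ => (θ * (Λ / θ) ^ σ) ^ K) ↔ σ * Real.log (Λ / θ) < Real.log θ⁻¹ := by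
  have hr0 : 0 < Λ / θ := div_pos hΛ hθ
  have hp : 0 < (Λ / θ) ^ σ := Real.rpow_pos_of_pos hr0 σ
  have hq0 : 0 < θ * (Λ / θ) ^ σ := mul_pos hθ hp
  rw [summable_geometric_iff_norm_lt_one, Real.norm_of_nonneg hq0.le, ← Real.exp_log hq0, Real.exp_lt_one_iff,
    Real.log_mul hθ.ne' hp.ne', Real.log_rpow hr0, Real.log_inv]
  constructor <;> intro h <;> linarith

/-- In particular for `θ < Λ`: summable iff `σ < log θ⁻¹ / log(Λ/θ)`. [folklore] -/
theorem summable_recentRate_pow_iff_lt_div {θ Λ : ℝ} (hθ : 0 < θ) (hθΛ : θ < Λ) (σ : ℝ) :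
    Summable (fun K : ℕ => (θ * (Λ / θ) ^ σ) ^ K) ↔ σ < Real.log θ⁻¹ / Real.log (Λ / θ) := by
  have hlr : 0 < Real.log (Λ / θ) := Real.log_pos ((one_lt_div hθ).2 hθΛ)
  rw [summable_recentRate_pow_iff hθ (hθ.trans hθΛ) σ, lt_div_iff₀ hlr]

end RecentRate

/-! ## §6 Sanity -/

section Sanity

/-- SANITY (non-vacuity of the running hypothesis of §4): the frozen trajectory `g_k = g` satisfies
`Step.Discrete031 0 0 K g` for every `K` (so §4 is not an artefact of an empty hypothesis; along it the window sizes
`e^{−p₀(g_j)}` are constant in `K`, the extreme case of decay slower than any power). [folklore] -/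
example (g : ℝ) (K : ℕ) : Step.Discrete031 0 0 K g (fun _ => g) := fun k _ => by simp

/-- SANITY (the threshold fires): with `Λ = 1`, `C = 0`, `ρ = e^{−1}`, `C′ = 2` the old-remnant count is summable
(`1 < 2·1 − 0`). [folklore] -/
example : Summable (fun K : ℕ => (1 : ℝ) ^ ageCut 0 K * Real.exp (-1) ^ ageCut 2 K) :=
  (summable_pow_ageCut_mul_iff le_rfl le_rfl (Real.exp_pos _) (Real.exp_lt_one_iff.2 (by norm_num))
    (by norm_num)).2 (by rw [Real.log_exp, Real.log_one]; norm_num)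

end Sanity

end Literature.MathematicalPhysics.QuantumFieldTheory.Balaban1983to89.T4BookingNecessity
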